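import Summits.BirchSwinnertonDyer.Rank1Residual.X1.AnomalousReduction
import Summits.BirchSwinnertonDyer.Rank1Residual.X1.AnomalousTowerLocalCondition
import Summits.BirchSwinnertonDyer.Rank1Residual.X2.GreenbergVatsalStrictAtP
import Literature.NumberTheory.GaloisRepresentations.LocalKroneckerWeberInertiaProofs
import Literature.NumberTheory.EllipticCurves.IwasawaCyclotomicProofs
import HarnessLib

/-!
# V79: at an ANOMALOUS good ordinary odd prime every class of `H¹(ℚ, E[p])` is STRICT at `𝔭` over
# `ℚ_∞` — the local hypothesis `hloc` of `X1/GeneratorCountAnomalous` is a THEOREM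
# (cell `b2b-bsdres`, unit `b2b-bsdres-eisenstein-p1`, gen 16)

HONEST FRAMING (run/shared/lean/b2b/bsd-rank1-residual/, verbatim in every file): the goal of the
cell is to DELETE the COMBINATION-SHAPED residual classes of the Birch–Swinnerton-Dyer formula for
ALL analytic-rank `≤ 1` elliptic curves over `ℚ` — "full BSD formula for every rank `≤ 1` curve in
class `C`" assembled STRICTLY from published theorems — so that the rank-`≤ 1` remainder becomes
exactly the CONSTRUCTION-SHAPED classes, which are TYPED (missing-input `Prop`s), NOT attempted.
This is not "finishing BSD". Sub-cell `b2b-bsdres-eisenstein-p1`: research route; NO CLAIM BEYOND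
STATED CLASSES; nothing here changes a label; nothing is booked. THEOREMS ONLY (no `def`, no named
fact, nothing asserted); where Greenberg's Prop. 2.4 enters it is the PUBLISHED named fact `hGrK`
(`Greenberg1999.imKummer_ge_strictCondition_goodOrdinary`) resp. the Coates–Greenberg record `hCG`.

What. `E/ℚ` globally minimal, `p` an ODD prime, `p ∤ Δ_E`, `p ∤ a_p`, `p ∣ #Ẽ(𝔽_p)` (anomalous),
`κ` the cyclotomic `ℤ_p`-extension, `v ∋ p`. For every `y ∈ H¹(ℚ, E[p])` the class
`h_0(Ψ y) ∈ H¹(ℚ_∞, E[p^∞])` is STRICT at `v` for Greenberg's datum `C_v = ker red_v`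
(`mem_strictKer_of_anomalous`), hence satisfies the Kummer condition over `ℚ_∞` at `𝔭`
(`hloc_of_anomalous`, Prop. 2.4 by name) — the hypothesis `hloc` of the count files
`X1/GeneratorCountAnomalous(Two/Leaf)` DISCHARGED on the X1 leaf. Proof (X1R0-GAPMAP §24.5):

* strict = inertia form over `ℚ_∞^{cyc}` (X2 `greenbergKer_eq_strictKer`), so it suffices that the
  cocycle `φ` of `y` has `red(φ(x)) = Õ` for `x ∈ I_v ∩ Gal(ℚ̄/ℚ_∞)`;
* CLAIM 1 (`X1/AnomalousReduction`): at an anomalous prime `Gal(K̄_v/ℚ_v)` fixes `red(E[p])`, so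
  `χ = red ∘ φ ∘ res : Gal(K̄_v/ℚ_v) → Ẽ[p]` is a HOMOMORPHISM with open kernel and values killed
  by `p` (`localRed_cocycle_apply_eq_zero`);
* CLAIM 3 (`apply_eq_one_of_mem_absInertia_of_mem_kerSubgroup`): by the LOCAL KRONECKER–WEBER
  theorem in inertia form (tree `adicCompletion_rat_exists_eq_comp_cyclotomicCharacter_of_mem_absInertia`,
  Serre *Local Fields* XIV §7 Thm. 2) `χ|_{I}` factors through `χ_p mod p^m`; on
  `I ∩ Gal(K̄_v/ℚ_{v,∞})` the cyclotomic character is TORSION (`κ` cyclotomic: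
  `ker κ = χ_p⁻¹(μ_{p−1})`, `PadicInt.torsion_units_le_rootsOfUnity`), so `χ^{p−1} = 1 = χ^p` there
  and `χ = 1` (`gcd(p − 1, p) = 1`). At `p = 2` the statement fails (the character of `ℚ₂(i)` is
  ramified on `Gal(ℚ̄₂/ℚ_{2,∞})`), whence `p ≠ 2`.

References: [GreenbergLNM1716] §2 Props. 2.2, 2.4 (pp. 73–75), §3 Lemma 3.4 (p. 89);
[SerreLocalFields1979] XIV §7 Thm. 2, IV §4 Prop. 17; [Washington1997] §13.1, Thm. 14.2;
[Mazur1972] §5; X1R0-GAPMAP §24.2, §24.5.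
-/

set_option autoImplicit false

noncomputable section

open scoped Classical

universe u

open Function Field NumberField IsDedekindDomain WeierstrassCurve
  Literature.NumberTheory.EllipticCurves Literature.NumberTheory.GaloisRepresentations
  Literature.NumberTheory.EllipticCurves.Greenberg1999 Literature.NumberTheory.EllipticCurves.GreenbergSelmer
  Summit.BirchSwinnertonDyer.Rank1Residual.X2.GreenbergVatsalReductionDatum

namespace Summit.BirchSwinnertonDyer.Rank1Residual.X1.AnomalousStrictAtP

variable (p : ℕ) [hp : Fact p.Prime] {v : HeightOneSpectrum (𝓞 ℚ)}

/-! ## §1 CLAIM 3: characters of `Gal(K̄_v/ℚ_v)` killed by `p` die on `I_v ∩ Gal(K̄_v/ℚ_{v,∞})` -/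

/-- **A character of `Gal(K̄_v/ℚ_v)` (`v ∣ p` odd) with open kernel and values killed by `p` is
trivial on the part of the inertia group fixing `ℚ_∞^{cyc}`.** By the local Kronecker–Weber theorem
in inertia form (`adicCompletion_rat_exists_eq_comp_cyclotomicCharacter_of_mem_absInertia`) `χ|_I`
factors through `χ_p mod p^m`; for `σ ∈ I` with `res σ ∈ ker κ` (`κ` cyclotomic:
`ker κ = χ_p⁻¹((ℤ_pˣ)_{tors})`, `χ_p ∘ res = χ_p`) the value `χ_p(σ)` is a `(p-1)`-th root of unity
(`PadicInt.torsion_units_le_rootsOfUnity`), so `χ(σ)^{p-1} = 1 = χ(σ)^p`, i.e. `χ(σ) = 1`.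
[cite: SerreLocalFields1979, Ch. XIV §7 Thm. 2] [cite: Washington1997, §13.1] -/
theorem apply_eq_one_of_mem_absInertia_of_mem_kerSubgroup (hp2 : p ≠ 2) (κ : ZpExtension ℚ p)
    (hκ : κ.IsCyclotomic) (hpv : ((p : ℕ) : 𝓞 ℚ) ∈ v.asIdeal) {M : Type*} [CommGroup M]
    (χ : absoluteGaloisGroup (v.adicCompletion ℚ) →* M)
    (hopen : IsOpen ((χ.ker : Subgroup (absoluteGaloisGroup (v.adicCompletion ℚ))) :
      Set (absoluteGaloisGroup (v.adicCompletion ℚ))))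
    (hM : ∀ s, χ s ^ p = 1) {σ : absoluteGaloisGroup (v.adicCompletion ℚ)}
    (hσI : σ ∈ absInertia (v.adicCompletion ℚ))
    (hσκ : absGaloisRestrict ℚ (v.adicCompletion ℚ) σ ∈ κ.kerSubgroup) : χ σ = 1 := by
  have hv : (Rat.HeightOneSpectrum.primesEquiv v : ℕ) = p :=
    Rat.HeightOneSpectrum.primesEquiv_eq_of_natCast_mem v hp.out hpv
  obtain ⟨m, -, g, hg⟩ := adicCompletion_rat_exists_eq_comp_cyclotomicCharacter_of_mem_absInertia
    p v hv χ hopen (fun a b ↦ mul_comm _ _)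
  -- `χ_p(σ)` is torsion, hence a `(p-1)`-th root of unity
  have htors : GaloisRep.cyclotomicCharacter (v.adicCompletion ℚ) p σ ∈ CommGroup.torsion ℤ_[p]ˣ := by
    have h := hσκ
    rw [hκ, Subgroup.mem_comap] at h
    change GaloisRep.cyclotomicCharacter ℚ p (absGaloisRestrict ℚ (v.adicCompletion ℚ) σ) ∈
      CommGroup.torsion ℤ_[p]ˣ at h
    rwa [cyclotomicCharacter_absGaloisRestrict] at h
  have hroot := PadicInt.torsion_units_le_rootsOfUnity htors
  have htO : Literature.NumberTheory.EllipticCurves.torsionOrder p = p - 1 := by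
    unfold Literature.NumberTheory.EllipticCurves.torsionOrder
      Literature.NumberTheory.EllipticCurves.cyclotomicExponent
    rw [if_neg hp2, pow_one, Nat.totient_prime hp.out]
  have h1 : χ σ ^ (p - 1) = 1 := by
    have hu : GaloisRep.cyclotomicCharacter (v.adicCompletion ℚ) p σ ^ (p - 1) = 1 := by
      rw [← htO]; exact (mem_rootsOfUnity _ _).mp hroot
    rw [hg σ hσI, ← map_pow, ← map_pow, hu, map_one, map_one]
  have hcop : (p - 1).Coprime p := (Nat.coprime_self_sub_left hp.out.one_le).mpr (Nat.coprime_one_left p)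
  have h := (pow_gcd_eq_one (M := M)).mpr ⟨h1, hM σ⟩
  rwa [Nat.Coprime.gcd_eq_one hcop, pow_one] at h

/-! ## §2 The reduction of the cocycle dies on `I_v ∩ Gal(K̄_v/ℚ_{v,∞})` -/

variable (W : WeierstrassCurve ℚ) [W.IsElliptic] [W.IsGloballyMinimal]

/-- **KEY: for a cocycle `φ` of a class of `H¹(ℚ, E[p])` at an anomalous good ordinary odd `v ∋ p`,
`red_v(φ(res σ)) = Õ` for every `σ` in the inertia group with `res σ ∈ Gal(ℚ̄/ℚ_∞)`.** By CLAIM 1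
(`AnomalousReduction.localRed_smul_eq_of_anomalous`) `σ ↦ red(φ(res σ))` is a homomorphism
`Gal(K̄_v/ℚ_v) → Ẽ(k̄_w)` (the twisted summand `res σ • φ(res τ)` has the same reduction as
`φ(res τ)`), with open kernel (it contains the open neighbourhood `{φ ∘ res = 0}` of `1`) and values
killed by `p`; conclude by §1. [cite: GreenbergLNM1716, §3 Lemma 3.4 (p. 89)]
[cite: SerreLocalFields1979, Ch. XIV §7 Thm. 2] -/
theorem localRed_cocycle_apply_eq_zero (hp2 : p ≠ 2) (hpv : ((p : ℕ) : 𝓞 ℚ) ∈ v.asIdeal)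
    (hΔ : ¬ (p : ℤ) ∣ minimalDiscriminantInt W) (hord : ¬ (p : ℤ) ∣ W.frobeniusTrace p)
    (hanom : p ∣ W.reductionPointCount p) (κ : ZpExtension ℚ p) (hκ : κ.IsCyclotomic)
    (φ : contOneCocycles (discreteTopRep (absoluteGaloisGroup ℚ) (geomTorsion W (p : ℤ))))
    {σ : absoluteGaloisGroup (v.adicCompletion ℚ)} (hσI : σ ∈ absInertia (v.adicCompletion ℚ))
    (hσκ : absGaloisRestrict ℚ (v.adicCompletion ℚ) σ ∈ κ.kerSubgroup) :
    localRed W p hpv hΔ (pointsMap W (v.adicCompletion ℚ)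
      ((φ.1 (absGaloisRestrict ℚ (v.adicCompletion ℚ) σ) : geomTorsion W (p : ℤ)) : W.geomPoints)) = 0 := by
  -- the values of `φ` are `p`-torsion
  have htor : ∀ g : absoluteGaloisGroup ℚ, (p : ℤ) • pointsMap W (v.adicCompletion ℚ)
      ((φ.1 g : geomTorsion W (p : ℤ)) : W.geomPoints) = 0 := fun g ↦ by
    rw [← map_zsmul, (Submodule.mem_torsionBy_iff (p : ℤ) _).1 (φ.1 g).2, map_zero]
  -- `χ₀ = red ∘ φ ∘ res` is additive (CLAIM 1)
  set χ₀ : absoluteGaloisGroup (v.adicCompletion ℚ) → _ := fun s ↦ localRed W p hpv hΔ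
    (pointsMap W (v.adicCompletion ℚ)
      ((φ.1 (absGaloisRestrict ℚ (v.adicCompletion ℚ) s) : geomTorsion W (p : ℤ)) : W.geomPoints))
    with hχ₀
  have hχ₀mul : ∀ a b, χ₀ (a * b) = χ₀ a + χ₀ b := by
    intro a b
    have e1 : ((φ.1 (absGaloisRestrict ℚ (v.adicCompletion ℚ) a *
        absGaloisRestrict ℚ (v.adicCompletion ℚ) b) : geomTorsion W (p : ℤ)) : W.geomPoints) =
        ((φ.1 (absGaloisRestrict ℚ (v.adicCompletion ℚ) a) : geomTorsion W (p : ℤ)) : W.geomPoints) +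
          absGaloisRestrict ℚ (v.adicCompletion ℚ) a •
            ((φ.1 (absGaloisRestrict ℚ (v.adicCompletion ℚ) b) : geomTorsion W (p : ℤ)) :
              W.geomPoints) := by
      rw [φ.2]; rfl
    simp only [hχ₀]
    rw [map_mul, e1, map_add, map_add, pointsMap_absGaloisRestrict_smul,
      AnomalousReduction.localRed_smul_eq_of_anomalous W p hpv hΔ hord hanom a (htor _)]
  have hχ₀one : χ₀ 1 = 0 := by
    simp only [hχ₀]
    rw [map_one, contOneCocycles.apply_one, ZeroMemClass.coe_zero, map_zero, map_zero]
  -- as a character into `Multiplicative Ẽ`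
  let χ : absoluteGaloisGroup (v.adicCompletion ℚ) →* Multiplicative _ :=
    { toFun := fun s ↦ Multiplicative.ofAdd (χ₀ s)
      map_one' := by rw [hχ₀one]; rfl
      map_mul' := fun a b ↦ by rw [hχ₀mul]; rfl }
  have hχ : ∀ s, χ s = Multiplicative.ofAdd (χ₀ s) := fun _ ↦ rfl
  -- open kernel
  have hopen : IsOpen ((χ.ker : Subgroup (absoluteGaloisGroup (v.adicCompletion ℚ))) :
      Set (absoluteGaloisGroup (v.adicCompletion ℚ))) := by
    apply Subgroup.isOpen_of_mem_nhds _ (g := 1)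
    have hU : IsOpen ((fun s ↦ φ.1 (absGaloisRestrict ℚ (v.adicCompletion ℚ) s)) ⁻¹'
        {(0 : geomTorsion W (p : ℤ))}) :=
      (isOpen_discrete _).preimage
        (φ.1.continuous.comp (absGaloisRestrict ℚ (v.adicCompletion ℚ)).continuous)
    refine Filter.mem_of_superset (hU.mem_nhds ?_) fun s hs ↦ ?_
    · rw [Set.mem_preimage, map_one, contOneCocycles.apply_one]; rfl
    · rw [Set.mem_preimage, Set.mem_singleton_iff] at hs
      rw [SetLike.mem_coe, MonoidHom.mem_ker, hχ, ofAdd_eq_one, hχ₀]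
      change localRed W p hpv hΔ (pointsMap W (v.adicCompletion ℚ)
        ((φ.1 (absGaloisRestrict ℚ (v.adicCompletion ℚ) s) : geomTorsion W (p : ℤ)) : W.geomPoints)) = 0
      rw [hs, ZeroMemClass.coe_zero, map_zero, map_zero]
  -- values killed by `p`
  have hχp : ∀ s, χ s ^ p = 1 := fun s ↦ by
    rw [hχ, ← ofAdd_nsmul, ofAdd_eq_one, ← natCast_zsmul]
    simp only [hχ₀]
    rw [← map_zsmul, htor, map_zero]
  -- CLAIM 3
  have h := apply_eq_one_of_mem_absInertia_of_mem_kerSubgroup p hp2 κ hκ hpv χ hopen hχp hσI hσκ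
  rwa [hχ, ofAdd_eq_one] at h

/-! ## §3 V79: strictness at an anomalous prime, and `hloc` -/

/-- **V79. STRICTNESS AT AN ANOMALOUS GOOD ORDINARY ODD PRIME**: for `p ∣ #Ẽ(𝔽_p)`, `κ` cyclotomic and
every `y ∈ H¹(ℚ, E[p])`, the class `h_0(Ψ y) ∈ H¹(ℚ_∞, E[p^∞])` is STRICT at `v ∋ p` for Greenberg's
reduction datum `C_v = ker red_v`. Strict = inertia form over `ℚ_∞^{cyc}`
(`X2.GreenbergVatsalStrictAtP.greenbergKer_eq_strictKer`), and on `I_v ∩ Gal(ℚ̄/ℚ_∞)` the reduction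
of the cocycle vanishes (§2). This is the mod-`p` shadow of Greenberg's Lemma 3.4 at an anomalous
prime (`#ker r_𝔭 = #Ẽ(𝔽_p)(p)²`). [cite: GreenbergLNM1716, §3 Lemma 3.4 (p. 89)]
[cite: GreenbergLNM1716, §2 pp. 73–75] -/
theorem mem_strictKer_of_anomalous (hp2 : p ≠ 2) (hΔ : ¬ (p : ℤ) ∣ minimalDiscriminantInt W)
    (hord : ¬ (p : ℤ) ∣ W.frobeniusTrace p) (hanom : p ∣ W.reductionPointCount p)
    (κ : ZpExtension ℚ p) (hκ : κ.IsCyclotomic) (v : HeightOneSpectrum (𝓞 ℚ))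
    (hpv : ((p : ℕ) : 𝓞 ℚ) ∈ v.asIdeal) (y : galH1Torsion W (p : ℤ)) :
    W.layerToInfty κ 0 (resH1Hom (Literature.NumberTheory.EllipticCurves.subgroupIncl (κ.layerSubgroup 0))
        (AddMonoidHom.id (geomPrimaryTorsion W p)) (fun _ _ ↦ rfl) (torsionToPrimaryH1 W p y)) ∈
      (reductionDatum W p hpv hΔ).strictKer κ.kerSubgroup := by
  rw [← X2.GreenbergVatsalStrictAtP.greenbergKer_eq_strictKer W p κ hκ hpv hΔ hord]
  -- `h_0 ∘ res_{K_0} = res_{K_∞}` on `H¹(ℚ, E[p^∞])`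
  have e1 : ∀ c : W.galH1Primary p,
      W.layerToInfty κ 0 (resH1Hom (Literature.NumberTheory.EllipticCurves.subgroupIncl (κ.layerSubgroup 0))
        (AddMonoidHom.id (geomPrimaryTorsion W p)) (fun _ _ ↦ rfl) c) =
      resH1Hom (Literature.NumberTheory.EllipticCurves.subgroupIncl κ.kerSubgroup)
        (AddMonoidHom.id (geomPrimaryTorsion W p)) (fun _ _ ↦ rfl) c := fun c ↦ by
    change resH1Hom (subgroupInclusion (κ.kerSubgroup_le_layerSubgroup 0))
      (AddMonoidHom.id (geomPrimaryTorsion W p)) (fun _ _ ↦ rfl) (resH1Hom _ _ _ c) = _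
    rw [resH1Hom_resH1Hom]
    exact DFunLike.congr_fun (resH1Hom_congr (by ext; rfl) (by ext; rfl) _ _) c
  obtain ⟨φ, rfl⟩ :=
    oneCocycleClass_surjective (discreteTopRep (absoluteGaloisGroup ℚ) (geomTorsion W (p : ℤ))) y
  rw [e1, torsionToPrimaryH1_oneCocycleClass, resH1Hom_oneCocycleClass]
  refine X2.GreenbergVatsalSelmerLink.oneCocycleClass_mem_greenbergKer_of_forall_mem κ.kerSubgroup
    _ (reductionDatum W p hpv hΔ) _ fun x ↦ ?_
  obtain ⟨hxH, hxI⟩ := (mem_inertiaIn_iff κ.kerSubgroup v _).1 x.2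
  obtain ⟨σ, hσI, hσx⟩ := Subgroup.mem_map.1 hxI
  rw [mem_reductionDatum_plus_iff, contOneCocycles.pullback_apply]
  change localRed W p hpv hΔ (pointsMap W (v.adicCompletion ℚ)
    ((AddSubgroup.inclusion (geomTorsion_le_geomPrimaryTorsion W p)
      (φ.1 (((x : decomp (K := ℚ) v) : absoluteGaloisGroup ℚ))) : geomPrimaryTorsion W p) :
        W.geomPoints)) = 0
  have hσx' : absGaloisRestrict ℚ (v.adicCompletion ℚ) σ =
      ((x : decomp (K := ℚ) v) : absoluteGaloisGroup ℚ) := hσx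
  rw [AddSubgroup.coe_inclusion, ← hσx']
  exact localRed_cocycle_apply_eq_zero p W hp2 hpv hΔ hord hanom κ hκ φ hσI (by rw [hσx']; exact hxH)

/-- **`hloc` AT AN ANOMALOUS GOOD ORDINARY ODD PRIME, Greenberg's Prop. 2.4 BY NAME** (`hGrK`): the
local hypothesis `hloc` of `X1/GeneratorCountAnomalous` §1 holds for `(E, p)` with `p ∣ #Ẽ(𝔽_p)` —
every `h_0(Ψ y)`, `y ∈ H¹(ℚ, E[p])`, satisfies the Kummer condition over `ℚ_∞` at the place above
`p` (V79 `mem_strictKer_of_anomalous` + gen 15 `hloc_of_forall_mem_strictKer`).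
[cite: GreenbergLNM1716, §2 Prop. 2.4 (pp. 74–75) and §3 Lemma 3.4 (p. 89)] -/
theorem hloc_of_anomalous (hGrK : imKummer_ge_strictCondition_goodOrdinary) (hp2 : p ≠ 2)
    (hΔ : ¬ (p : ℤ) ∣ minimalDiscriminantInt W) (hord : ¬ (p : ℤ) ∣ W.frobeniusTrace p)
    (hanom : p ∣ W.reductionPointCount p) :
    ∀ (κ : ZpExtension ℚ p), κ.IsCyclotomic → ∀ (v : HeightOneSpectrum (𝓞 ℚ)),
      ((p : ℕ) : 𝓞 ℚ) ∈ v.asIdeal → ∀ y : galH1Torsion W (p : ℤ),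
      W.layerToInfty κ 0 (resH1Hom (Literature.NumberTheory.EllipticCurves.subgroupIncl (κ.layerSubgroup 0))
          (AddMonoidHom.id (geomPrimaryTorsion W p)) (fun _ _ ↦ rfl) (torsionToPrimaryH1 W p y)) ∈
        W.localKerOver p κ.kerSubgroup (v.adicCompletion ℚ) :=
  AnomalousTowerLocalCondition.hloc_of_forall_mem_strictKer W p hGrK hΔ hord
    fun κ hκ v hpv y ↦ mem_strictKer_of_anomalous p W hp2 hΔ hord hanom κ hκ v hpv y

/-- The same with the Coates–Greenberg record `hCG` as the named fact (Prop. 2.4 DERIVED from it in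
the tree, `Additive.GoodModelLine.imKummer_ge_strictCondition_goodOrdinary_of_coatesGreenberg`).
[cite: CoatesGreenberg1996, Cor. 3.2 (through GreenbergLNM1716, Coates p. 37 (74))]
[cite: GreenbergLNM1716, §2 Prop. 2.4 (pp. 74–75)] -/
theorem hloc_of_anomalous_of_coatesGreenberg
    (hCG : CoatesGreenberg1996.H1_goodModelKernel_trivial.{0}) (hp2 : p ≠ 2)
    (hΔ : ¬ (p : ℤ) ∣ minimalDiscriminantInt W) (hord : ¬ (p : ℤ) ∣ W.frobeniusTrace p)
    (hanom : p ∣ W.reductionPointCount p) :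
    ∀ (κ : ZpExtension ℚ p), κ.IsCyclotomic → ∀ (v : HeightOneSpectrum (𝓞 ℚ)),
      ((p : ℕ) : 𝓞 ℚ) ∈ v.asIdeal → ∀ y : galH1Torsion W (p : ℤ),
      W.layerToInfty κ 0 (resH1Hom (Literature.NumberTheory.EllipticCurves.subgroupIncl (κ.layerSubgroup 0))
          (AddMonoidHom.id (geomPrimaryTorsion W p)) (fun _ _ ↦ rfl) (torsionToPrimaryH1 W p y)) ∈
        W.localKerOver p κ.kerSubgroup (v.adicCompletion ℚ) :=
  AnomalousTowerLocalCondition.hloc_of_forall_mem_strictKer_of_coatesGreenberg W p hCG hΔ hord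
    fun κ hκ v hpv y ↦ mem_strictKer_of_anomalous p W hp2 hΔ hord hanom κ hκ v hpv y

end Summit.BirchSwinnertonDyer.Rank1Residual.X1.AnomalousStrictAtP

end
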